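import Summits.QuantumFields.YangMills.Theses.CovariantDischarge
import HarnessLib

/-!
# Route `CovariantDischarge` — the assembly item (stmt-QuantumFields-22896), by modus ponens

`Assembly = MinimiserStabilityRegPr → FluctuationComparisonRegPrIntL → LevelOneWindowTailL → FractionalWindowTailL → DeepWindowTailL →
HistoryTailOfSplit → YM3TorusSU2` is exactly the route's deciding theorem `CovariantDischarge.closes` (planner ym-r3-idea-2 g6, LINE 12,
kernel-checked in the route file: `UnitScaleTilt.closes h200 h201 (hG h1 hF hD)`) read as an implication.  Free-hands width seat `ym-t4-w11`
(cell ym-fleet).  Pure plumbing: no summit / leaf / crux statement is proved — the rung-R3 leaf `YM3TorusSU2` follows only from the route's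
open cruxes.
-/

namespace Summit.QuantumFields.YangMills.Theorems.CovariantDischarge

/-- **`CovariantDischarge.Assembly` (stmt-QuantumFields-22896)**: the six items give the rung-R3 leaf, by the route's deciding theorem
`closes`. [cite: Balaban1985UV3, (7) p.257] -/
theorem covariantDischarge_assembly_proof : Summit.QuantumFields.YangMills.Theses.CovariantDischarge.Assembly :=
  -- bf2-g30 re-glue (route rev 3, 2026-08-29T06:58Z, re-keyed `closes` to the Sandwich binders): the rev-0 glue inlined through the parent
  -- route's deciding theorem `UnitScaleTilt.closes` — statement byte-identical.
  fun h200 h201 h1 hF hD hG => Summit.QuantumFields.YangMills.Theses.UnitScaleTilt.closes h200 h201 (hG h1 hF hD)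

end Summit.QuantumFields.YangMills.Theorems.CovariantDischarge
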